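import Literature.LinearAlgebra.Matrix.PerronSymmetric
import Mathlib.Algebra.Order.Chebyshev
import HarnessLib

/-!
# The power method in trace form, and the spectraplex bounds it feeds

Topic `LinearAlgebra/Matrix`, continuing `PerronSymmetric.lean` (real symmetric matrices,
`topEigenvalue`, the Rayleigh bound `xᵀAx ≤ λ_max xᵀx`, spectral coordinates, `Aᴹ = U diag(λᴹ) Uᵀ`,
`Tr(Aᴹ) = ∑ λᵢᴹ`). Everything here is PROVED; the statements are the elementary linear algebra
behind a first-order semidefinite approximation scheme (Frank–Wolfe over the spectraplex
`Δ = {B ⪰ 0, Tr B = 1}` with the linear minimisation oracle replaced by a normalised matrix power),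
used to discharge `Literature.Computability.Complexity.GLS1981_thetaApprox_unary_FP`:

* **power method, trace form** (`trace_pow_succ_ge`): for a real symmetric positive semidefinite
  `A` on `N` coordinates and `0 ≤ ε ≤ 1`, `N (1 - ε)ʳ ≤ ε` implies
  `Tr(A^{r+1}) ≥ (1 - ε)² λ_max Tr(Aʳ)`, i.e. the normalised power `W = Aʳ / Tr(Aʳ)` (a point of
  `Δ`) has `⟨A, W⟩ ≥ (1 - ε)² λ_max = (1 - ε)² max_{B ∈ Δ} ⟨A, B⟩` (the classical gap-free analysis of
  power iteration — eigenvalues below `(1 - ε) λ_max` are damped by `(1 - ε)ʳ`, the top eigenvalue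
  alone contributes `λ_maxʳ` to the trace; Golub–Van Loan 2013, §8.2.1, proof of Thm. 8.2.1:
  `λ⁽ᵏ⁾ = ∑ aᵢ²λᵢ^{2k+1} / ∑ aᵢ²λᵢ^{2k}` — here summed over all start vectors `eᵢ`, which needs no
  assumption on the start vector nor on the spectral gap);
  `topEigenvalue_pow_le_trace_pow`, `trace_pow_pos` make the normalisation legitimate;
* **the spectraplex bound** (`trace_mul_le_topEigenvalue_mul_trace`): `⟨G, B⟩ = Tr(G B) ≤ λ_max(G) Tr B`
  for symmetric `G` and positive semidefinite `B` (so `max_{B ∈ Δ} ⟨G, B⟩ = λ_max(G)`);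
* **Frobenius versus trace on the cone** (`sum_sq_le_trace_sq`): `∑ᵢⱼ Bᵢⱼ² ≤ (Tr B)²` for `B ⪰ 0`;
* **Gershgorin-type shift** (`abs_dotProduct_mulVec_le`, `posSemidef_add_smul_one`): if
  `|Gᵢⱼ| ≤ g` then `|xᵀGx| ≤ N g · xᵀx`, hence `G + c·1 ⪰ 0` for `c ≥ N g`.

## References

* G. H. Golub, C. F. Van Loan, *Matrix Computations*, 4th ed. (2013), §8.2.1, Thm. 8.2.1 and its
  proof (held, `lit read book:golub2012-matrix-computations`, PDF pp. 420–421) [GolubVanLoan2013].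
* R. A. Horn, C. R. Johnson, *Matrix Analysis*, 2nd ed. (2013), Thm. 4.2.2 (Rayleigh) (held,
  `lit read book:horn2012-matrix-analysis`, PDF p. 303) [HornJohnson2013].
-/

noncomputable section

open Matrix Finset

namespace Literature.LinearAlgebra.Matrix

variable {n : Type*} [Fintype n] [DecidableEq n]

/-! ### Sums of powers: the gap-free damping estimate -/

/-- The arithmetic heart of the power method: for weights `0 ≤ μᵢ` with the value `Λ` attained, and
`#ι · (1 - ε)ʳ ≤ ε`, `∑ μᵢ^{r+1} ≥ (1 - ε)² Λ ∑ μᵢʳ` (indices with `μᵢ < (1 - ε)Λ` carry at most an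
`ε`-fraction of `∑ μᵢʳ ≥ Λʳ`). [folklore] -/
theorem sum_pow_succ_ge {ι : Type*} [Fintype ι] (μ : ι → ℝ) {Λ ε : ℝ} {r : ℕ}
    (h0 : ∀ i, 0 ≤ μ i) (hmax : ∃ i, μ i = Λ) (hε0 : 0 ≤ ε) (hε1 : ε ≤ 1)
    (hr : (Fintype.card ι : ℝ) * (1 - ε) ^ r ≤ ε) :
    (1 - ε) ^ 2 * Λ * ∑ i, μ i ^ r ≤ ∑ i, μ i ^ (r + 1) := by
  obtain ⟨i₀, hi₀⟩ := hmax
  have hΛ : 0 ≤ Λ := hi₀ ▸ h0 i₀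
  have h1ε : 0 ≤ 1 - ε := sub_nonneg.2 hε1
  set S := ∑ i, μ i ^ r with hS
  -- the whole sum dominates the top term
  have hSΛ : Λ ^ r ≤ S := by
    rw [hS, ← hi₀]
    exact single_le_sum (f := fun i => μ i ^ r) (fun i _ => pow_nonneg (h0 i) r) (mem_univ i₀)
  -- good and bad indices
  set good := univ.filter fun i => (1 - ε) * Λ ≤ μ i with hgood
  set bad := univ.filter fun i => ¬ (1 - ε) * Λ ≤ μ i with hbad
  have hsplit : S = ∑ i ∈ good, μ i ^ r + ∑ i ∈ bad, μ i ^ r := by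
    rw [hS, hgood, hbad, sum_filter_add_sum_filter_not]
  have hsplit' : ∑ i, μ i ^ (r + 1) = ∑ i ∈ good, μ i ^ (r + 1) + ∑ i ∈ bad, μ i ^ (r + 1) := by
    rw [hgood, hbad, sum_filter_add_sum_filter_not]
  -- the bad part is small
  have hbadle : ∑ i ∈ bad, μ i ^ r ≤ ε * S := by
    calc ∑ i ∈ bad, μ i ^ r ≤ ∑ i ∈ bad, ((1 - ε) * Λ) ^ r := by
          refine sum_le_sum fun i hi => ?_
          have hlt : μ i < (1 - ε) * Λ := not_le.1 (mem_filter.1 hi).2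
          exact pow_le_pow_left₀ (h0 i) hlt.le r
      _ = (bad.card : ℝ) * ((1 - ε) * Λ) ^ r := by rw [sum_const, nsmul_eq_mul]
      _ ≤ (Fintype.card ι : ℝ) * ((1 - ε) * Λ) ^ r := by
          refine mul_le_mul_of_nonneg_right ?_ (pow_nonneg (mul_nonneg h1ε hΛ) r)
          exact_mod_cast card_le_univ bad
      _ = ((Fintype.card ι : ℝ) * (1 - ε) ^ r) * Λ ^ r := by rw [mul_pow]; ring
      _ ≤ ε * Λ ^ r := mul_le_mul_of_nonneg_right hr (pow_nonneg hΛ r)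
      _ ≤ ε * S := mul_le_mul_of_nonneg_left hSΛ hε0
  -- the good part carries the mass and gains a factor `(1 - ε) Λ`
  have hgoodge : (1 - ε) * Λ * ∑ i ∈ good, μ i ^ r ≤ ∑ i ∈ good, μ i ^ (r + 1) := by
    rw [mul_sum]
    refine sum_le_sum fun i hi => ?_
    have hge : (1 - ε) * Λ ≤ μ i := (mem_filter.1 hi).2
    rw [pow_succ]
    rw [mul_comm]
    exact mul_le_mul_of_nonneg_left hge (pow_nonneg (h0 i) r)
  have hbad0 : 0 ≤ ∑ i ∈ bad, μ i ^ (r + 1) := sum_nonneg fun i _ => pow_nonneg (h0 i) _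
  calc (1 - ε) ^ 2 * Λ * S = (1 - ε) * Λ * ((1 - ε) * S) := by ring
    _ = (1 - ε) * Λ * (S - ε * S) := by ring
    _ ≤ (1 - ε) * Λ * ∑ i ∈ good, μ i ^ r := by
        refine mul_le_mul_of_nonneg_left ?_ (mul_nonneg h1ε hΛ)
        linarith [hsplit, hbadle]
    _ ≤ ∑ i ∈ good, μ i ^ (r + 1) := hgoodge
    _ ≤ ∑ i, μ i ^ (r + 1) := by rw [hsplit']; linarith

/-! ### The power method in trace form -/

variable {A : Matrix n n ℝ}

/-- The top eigenvalue of a positive semidefinite matrix controls the trace of its powers from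
below: `λ_maxʳ ≤ Tr(Aʳ) = ∑ λᵢʳ` (all terms nonnegative). [folklore] -/
theorem topEigenvalue_pow_le_trace_pow [Nonempty n] (hA : A.PosSemidef) (r : ℕ) :
    topEigenvalue hA.1 ^ r ≤ (A ^ r).trace := by
  rw [trace_pow_eq_sum hA.1 r]
  obtain ⟨i₀, hi₀⟩ := exists_eigenvalues_eq_topEigenvalue hA.1
  rw [← hi₀]
  exact single_le_sum (f := fun i => hA.1.eigenvalues i ^ r)
    (fun i _ => pow_nonneg (hA.eigenvalues_nonneg i) r) (mem_univ i₀)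

/-- For a positive semidefinite matrix the top eigenvalue is nonnegative. [folklore] -/
theorem topEigenvalue_nonneg [Nonempty n] (hA : A.PosSemidef) : 0 ≤ topEigenvalue hA.1 := by
  obtain ⟨i₀, hi₀⟩ := exists_eigenvalues_eq_topEigenvalue hA.1
  rw [← hi₀]; exact hA.eigenvalues_nonneg i₀

/-- For a positive semidefinite matrix, `Tr A ≤ N λ_max` (each eigenvalue is at most the top
one), so a nonzero such matrix has `λ_max > 0`. [folklore] -/
theorem trace_le_card_mul_topEigenvalue [Nonempty n] (hA : A.IsHermitian) :
    A.trace ≤ Fintype.card n * topEigenvalue hA := by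
  rw [hA.trace_eq_sum_eigenvalues]
  simp only [RCLike.ofReal_real_eq_id, id_eq]
  calc ∑ i, hA.eigenvalues i ≤ ∑ _i : n, topEigenvalue hA :=
        sum_le_sum fun i _ => eigenvalues_le_topEigenvalue hA i
    _ = Fintype.card n * topEigenvalue hA := by rw [sum_const, nsmul_eq_mul, card_univ]

/-- Powers of a positive semidefinite matrix with positive trace have positive trace
(`Tr(Aʳ) ≥ λ_maxʳ > 0`). [folklore] -/
theorem trace_pow_pos [Nonempty n] (hA : A.PosSemidef) (htr : 0 < A.trace) (r : ℕ) :
    0 < (A ^ r).trace := by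
  have hΛ : 0 < topEigenvalue hA.1 := by
    have h := trace_le_card_mul_topEigenvalue hA.1
    have hc : (0 : ℝ) < Fintype.card n := by exact_mod_cast Fintype.card_pos
    nlinarith
  exact lt_of_lt_of_le (pow_pos hΛ r) (topEigenvalue_pow_le_trace_pow hA r)

/-- **The power method, trace form.** For a real symmetric positive semidefinite `A` on `N`
coordinates, `0 ≤ ε ≤ 1` and an exponent `r` with `N (1 - ε)ʳ ≤ ε`:
`(1 - ε)² λ_max · Tr(Aʳ) ≤ Tr(A^{r+1})`. Equivalently the normalised power `W = Aʳ/Tr(Aʳ)`, a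
positive semidefinite matrix of trace one, satisfies `⟨A, W⟩ ≥ (1 - ε)² λ_max(A)`: power iteration
run from all coordinate vectors at once finds the top of the spectrum up to the factor `(1 - ε)²`
after `r = O(ε⁻¹ log(N/ε))` steps, with no spectral-gap assumption (the printed Thm. 8.2.1 of
Golub–Van Loan assumes a gap `|λ₁| > |λ₂|` and one start vector; this is the gap-free, all-starts
variant of the same computation `λ⁽ᵏ⁾ = ∑ aᵢ²λᵢ^{2k+1} / ∑ aᵢ²λᵢ^{2k}` in its proof).
[cite: GolubVanLoan2013, §8.2.1, Thm. 8.2.1 and proof (PDF pp. 420–421)] -/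
theorem trace_pow_succ_ge [Nonempty n] (hA : A.PosSemidef) {ε : ℝ} (hε0 : 0 ≤ ε) (hε1 : ε ≤ 1)
    {r : ℕ} (hr : (Fintype.card n : ℝ) * (1 - ε) ^ r ≤ ε) :
    (1 - ε) ^ 2 * topEigenvalue hA.1 * (A ^ r).trace ≤ (A ^ (r + 1)).trace := by
  rw [trace_pow_eq_sum hA.1 r, trace_pow_eq_sum hA.1 (r + 1)]
  exact sum_pow_succ_ge hA.1.eigenvalues hA.eigenvalues_nonneg
    (exists_eigenvalues_eq_topEigenvalue hA.1) hε0 hε1 hr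

/-! ### The spectraplex bound `Tr(G B) ≤ λ_max(G) Tr B` -/

variable {G B : Matrix n n ℝ}

/-- **Linear functions on the spectraplex are maximised at the top eigenvalue**: for symmetric
`G` and positive semidefinite `B`, `Tr(G B) ≤ λ_max(G) · Tr B` (expand `B = ∑ μₖ uₖuₖᵀ`, `μₖ ≥ 0`,
and use the Rayleigh bound `uₖᵀGuₖ ≤ λ_max`, Horn–Johnson Thm. 4.2.2).
[cite: HornJohnson2013, Thm. 4.2.2 (Rayleigh, PDF p. 303)] -/
theorem trace_mul_le_topEigenvalue_mul_trace [Nonempty n] (hG : G.IsHermitian) (hB : B.PosSemidef) :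
    (G * B).trace ≤ topEigenvalue hG * B.trace := by
  have h := trace_mul_pow_eq_sum hB.1 G 1
  rw [pow_one] at h
  rw [h, hB.1.trace_eq_sum_eigenvalues]
  simp only [RCLike.ofReal_real_eq_id, id_eq, pow_one, mul_sum]
  refine sum_le_sum fun i _ => ?_
  rw [star_eigU_mul_mul_eigU_apply]
  have hray := dotProduct_mulVec_le hG (hB.1.eigenvectorBasis i).ofLp
  rw [eigenvectorBasis_dotProduct hB.1 i i, if_pos rfl, mul_one] at hray
  exact mul_le_mul_of_nonneg_right hray (hB.eigenvalues_nonneg i)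

/-! ### Frobenius norm versus trace on the positive cone -/

/-- For a real symmetric matrix, `∑ᵢⱼ Bᵢⱼ² = Tr(B²)`. [folklore] -/
theorem sum_sq_eq_trace_sq (hB : B.IsHermitian) : ∑ i, ∑ j, B i j ^ 2 = (B ^ 2).trace := by
  rw [pow_two, Matrix.trace]
  simp only [Matrix.diag, Matrix.mul_apply]
  refine sum_congr rfl fun i _ => sum_congr rfl fun j _ => ?_
  have hsymm : B j i = B i j := by
    have h := congrFun (congrFun hB i) j
    simpa [conjTranspose_apply] using h
  rw [hsymm, pow_two]

/-- **Frobenius norm on the cone**: `∑ᵢⱼ Bᵢⱼ² ≤ (Tr B)²` for positive semidefinite `B`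
(`∑ λᵢ² ≤ (∑ λᵢ)²` for nonnegative eigenvalues); in particular matrices of the spectraplex have
Frobenius norm at most one. [folklore] -/
theorem sum_sq_le_trace_sq (hB : B.PosSemidef) : ∑ i, ∑ j, B i j ^ 2 ≤ B.trace ^ 2 := by
  rw [sum_sq_eq_trace_sq hB.1, trace_pow_eq_sum hB.1 2, hB.1.trace_eq_sum_eigenvalues]
  simp only [RCLike.ofReal_real_eq_id, id_eq]
  have h0 := hB.eigenvalues_nonneg
  rw [sq, sum_mul]
  refine sum_le_sum fun i _ => ?_
  rw [sq]
  exact mul_le_mul_of_nonneg_left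
    (single_le_sum (f := fun j => hB.1.eigenvalues j) (fun j _ => h0 j) (mem_univ i)) (h0 i)

/-! ### A Gershgorin-type shift into the positive cone -/

omit [DecidableEq n] in
/-- If all entries of `G` are bounded by `g` in absolute value then `|xᵀGx| ≤ N g · xᵀx`
(`|xᵀGx| ≤ g (∑ |xᵢ|)² ≤ g N ∑ xᵢ²`, Cauchy–Schwarz). [folklore] -/
theorem abs_dotProduct_mulVec_le {g : ℝ} (hg : ∀ i j, |G i j| ≤ g) (x : n → ℝ) :
    |x ⬝ᵥ (G *ᵥ x)| ≤ Fintype.card n * g * (x ⬝ᵥ x) := by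
  rcases isEmpty_or_nonempty n with hn | hn
  · simp [dotProduct]
  have hg0 : 0 ≤ g := by
    obtain ⟨i⟩ := hn
    exact (abs_nonneg _).trans (hg i i)
  calc |x ⬝ᵥ (G *ᵥ x)| = |∑ i, ∑ j, x i * (G i j * x j)| := by
        simp only [dotProduct, mulVec, mul_sum]
    _ ≤ ∑ i, ∑ j, |x i| * (g * |x j|) := by
        refine (abs_sum_le_sum_abs _ _).trans (sum_le_sum fun i _ => ?_)
        refine (abs_sum_le_sum_abs _ _).trans (sum_le_sum fun j _ => ?_)
        rw [abs_mul, abs_mul]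
        exact mul_le_mul_of_nonneg_left (mul_le_mul_of_nonneg_right (hg i j) (abs_nonneg _))
          (abs_nonneg _)
    _ = g * (∑ i, |x i|) ^ 2 := by
        rw [sq, sum_mul_sum, mul_sum]
        refine sum_congr rfl fun i _ => ?_
        rw [mul_sum]
        exact sum_congr rfl fun j _ => by ring
    _ ≤ g * (Fintype.card n * ∑ i, |x i| ^ 2) := by
        refine mul_le_mul_of_nonneg_left ?_ hg0
        have h := sq_sum_le_card_mul_sum_sq (s := (univ : Finset n)) (f := fun i => |x i|)
        simpa using h
    _ = Fintype.card n * g * (x ⬝ᵥ x) := by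
        rw [dotProduct]
        have : ∑ i, |x i| ^ 2 = ∑ i, x i * x i := sum_congr rfl fun i _ => by rw [sq_abs, sq]
        rw [this]; ring

omit [DecidableEq n] in
/-- **Shifting a bounded symmetric matrix into the cone**: if `G` is symmetric with `|Gᵢⱼ| ≤ g` and
`c ≥ N g`, then `G + c·1` is positive semidefinite. [folklore] -/
theorem posSemidef_add_smul_one [DecidableEq n] (hG : G.IsHermitian) {g c : ℝ} (hg : ∀ i j, |G i j| ≤ g)
    (hc : Fintype.card n * g ≤ c) : (G + c • (1 : Matrix n n ℝ)).PosSemidef := by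
  have h1 : (G + c • (1 : Matrix n n ℝ)).IsHermitian := by
    rw [Matrix.IsHermitian, conjTranspose_add, conjTranspose_smul, conjTranspose_one, star_trivial,
      hG.eq]
  refine PosSemidef.of_dotProduct_mulVec_nonneg h1 fun x => ?_
  · rw [star_trivial, add_mulVec, dotProduct_add, smul_mulVec, one_mulVec, dotProduct_smul,
      smul_eq_mul]
    have h := abs_dotProduct_mulVec_le hg x
    have hxx : 0 ≤ x ⬝ᵥ x := by
      rw [dotProduct]; exact sum_nonneg fun i _ => mul_self_nonneg _
    have h1 : -(x ⬝ᵥ (G *ᵥ x)) ≤ Fintype.card n * g * (x ⬝ᵥ x) := (neg_le_abs _).trans h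
    nlinarith [mul_le_mul_of_nonneg_right hc hxx]

end Literature.LinearAlgebra.Matrix

end
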